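import Mathlib.Analysis.Calculus.Deriv.Inv
import Mathlib.Analysis.Calculus.Deriv.Mul
import Mathlib.Analysis.Calculus.Deriv.Add
import Mathlib.Tactic.Positivity
import Mathlib.Tactic.FieldSimp
import Mathlib.Tactic.Linarith
import HarnessLib

/-!
# The Kontsevich–Zagier conjecture in dimension `≤ 1`, Id: the Möbius map

Elementary real analysis of the Möbius map `φ_σ(u) = (u + σ)/(1 − σu)` (addition of the angle
`arctan σ` under `u = tan θ`) and its inverse `ψ_σ(v) = (v − σ)/(1 + σv)`, for `σ ≥ 0`:
`φ_σ` maps `[0, ψ_σ(ρ)]` onto `[σ, ρ]` injectively with derivative `(1+σ²)/(1−σu)²`, and the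
Jacobian identity `(1−σu)² + (u+σ)² = (1+σ²)(1+u²)` shows that `φ_σ` preserves the form
`du/(1+u²)`.  Used in `SoloBlindCells` for the Möbius move on arctangent cells.
-/

noncomputable section

open Set

namespace Summit.KontsevichZagierPeriods.KontsevichZagierPeriods.Theorems

namespace SoloBlind

/-! ### The Möbius move -/

/-- The Möbius map `u ↦ (u + σ)/(1 − σ u)` ("addition of the angle `arctan σ`"). -/
def moebius (σ u : ℝ) : ℝ := (u + σ) / (1 - σ * u)

/-- Its inverse `v ↦ (v − σ)/(1 + σ v)`. -/
def moebiusInv (σ v : ℝ) : ℝ := (v - σ) / (1 + σ * v)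

/-- On `[0, ψ_σ(ρ)]` the Möbius denominator `1 − σu` is positive. -/
theorem one_sub_mul_pos_of_le {σ ρ u : ℝ} (hσ : 0 ≤ σ) (hσρ : σ ≤ ρ)
    (hu : u ≤ moebiusInv σ ρ) : 0 < 1 - σ * u := by
  have hden : 0 < 1 + σ * ρ := by nlinarith
  have h1 : σ * moebiusInv σ ρ < 1 := by
    rw [moebiusInv, ← mul_div_assoc, div_lt_one hden]
    nlinarith [sq_nonneg σ]
  nlinarith [mul_le_mul_of_nonneg_left hu hσ]

/-- `ψ_σ(ρ) ≥ 0` for `0 ≤ σ ≤ ρ`. -/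
theorem moebiusInv_nonneg {σ ρ : ℝ} (hσ : 0 ≤ σ) (hσρ : σ ≤ ρ) : 0 ≤ moebiusInv σ ρ :=
  div_nonneg (by linarith) (by nlinarith)

/-- The Möbius map sends `[0, ψ_σ(ρ)]` into `[σ, ρ]`. -/
theorem moebius_mem_Icc {σ ρ u : ℝ} (hσ : 0 ≤ σ) (hσρ : σ ≤ ρ) (hu0 : 0 ≤ u)
    (hu : u ≤ moebiusInv σ ρ) : moebius σ u ∈ Icc σ ρ := by
  have hden := one_sub_mul_pos_of_le hσ hσρ hu
  have hden' : 0 < 1 + σ * ρ := by nlinarith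
  constructor
  · rw [moebius, le_div_iff₀ hden]
    nlinarith [sq_nonneg σ]
  · rw [moebius, div_le_iff₀ hden]
    have : u * (1 + σ * ρ) ≤ ρ - σ := by
      have := hu; rwa [moebiusInv, le_div_iff₀ hden'] at this
    nlinarith

/-- The inverse Möbius map sends `[σ, ρ]` into `[0, ψ_σ(ρ)]`. -/
theorem moebiusInv_mem_Icc {σ ρ v : ℝ} (hσ : 0 ≤ σ) (hv : v ∈ Icc σ ρ) :
    moebiusInv σ v ∈ Icc 0 (moebiusInv σ ρ) := by
  have h1 : 0 < 1 + σ * v := by nlinarith [hv.1]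
  have h2 : 0 < 1 + σ * ρ := by nlinarith [hv.1, hv.2]
  constructor
  · exact div_nonneg (by linarith [hv.1]) h1.le
  · rw [moebiusInv, moebiusInv, div_le_div_iff₀ h1 h2]
    nlinarith [hv.1, hv.2, sq_nonneg σ]

/-- `φ_σ ∘ ψ_σ = id` on `[σ, ∞)`. -/
theorem moebius_moebiusInv {σ v : ℝ} (hσ : 0 ≤ σ) (hv : σ ≤ v) :
    moebius σ (moebiusInv σ v) = v := by
  have h1 : (1 + σ * v) ≠ 0 := by nlinarith
  have h3 : (1 : ℝ) + σ ^ 2 ≠ 0 := by positivity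
  have hd : 1 - σ * ((v - σ) / (1 + σ * v)) = (1 + σ ^ 2) / (1 + σ * v) := by
    rw [← mul_div_assoc, eq_div_iff h1, sub_mul, div_mul_cancel₀ _ h1]
    ring
  have hn : (v - σ) / (1 + σ * v) + σ = v * (1 + σ ^ 2) / (1 + σ * v) := by
    rw [eq_div_iff h1, add_mul, div_mul_cancel₀ _ h1]
    ring
  rw [moebius, moebiusInv, hd, hn, div_div_div_cancel_right₀ h1, mul_div_cancel_right₀ v h3]

/-- The Möbius map is injective where its denominator is positive. -/
theorem moebius_injOn {σ : ℝ} {S : Set ℝ} (hS : ∀ u ∈ S, 0 < 1 - σ * u) : InjOn (moebius σ) S := by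
  intro u hu v hv h
  have hu' := hS u hu
  have hv' := hS v hv
  rw [moebius, moebius, div_eq_div_iff hu'.ne' hv'.ne'] at h
  nlinarith [sq_nonneg σ, sq_nonneg (u - v), mul_pos hu' hv']

/-- Derivative of the Möbius map: `φ_σ'(u) = (1+σ²)/(1−σu)²`. -/
theorem hasDerivAt_moebius {σ u : ℝ} (hu : 1 - σ * u ≠ 0) :
    HasDerivAt (moebius σ) ((1 + σ ^ 2) / (1 - σ * u) ^ 2) u := by
  have h1 : HasDerivAt (fun u => u + σ) 1 u := (hasDerivAt_id u).add_const σ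
  have h2 : HasDerivAt (fun u => 1 - σ * u) (-σ) u := by
    simpa using ((hasDerivAt_id u).const_mul σ).const_sub 1
  have h : HasDerivAt (fun u => (u + σ) / (1 - σ * u))
      (((1 : ℝ) * (1 - σ * u) - (u + σ) * (-σ)) / (1 - σ * u) ^ 2) u := h1.div h2 hu
  have e : ((1 : ℝ) * (1 - σ * u) - (u + σ) * (-σ)) / (1 - σ * u) ^ 2 =
      (1 + σ ^ 2) / (1 - σ * u) ^ 2 := by
    congr 1
    ring
  rw [e] at h
  exact h

/-- The Jacobian identity of the Möbius map: `(1 − σu)² + (u + σ)² = (1 + σ²)(1 + u²)`. -/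
theorem moebius_jacobian_identity (σ u : ℝ) :
    (1 - σ * u) ^ 2 + (u + σ) ^ 2 = (1 + σ ^ 2) * (1 + u ^ 2) := by ring

end SoloBlind

end Summit.KontsevichZagierPeriods.KontsevichZagierPeriods.Theorems
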